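import Mathlib.NumberTheory.PrimeCounting
import Mathlib.Analysis.SpecialFunctions.Pow.Continuity
import Mathlib.Analysis.SpecialFunctions.Log.Basic
import Mathlib.Analysis.Normed.Group.FunctionSeries
import Mathlib.Topology.Algebra.InfiniteSum.Real
import Literature.NumberTheory.LFunctions.LogEulerProduct
import HarnessLib

/-!
# Levin–Faĭnleĭb mean-value theorem, II: the local Euler factors

Topic `Literature/NumberTheory/LFunctions`. Second file of the proof of the logarithmic mean-value
theorem of Levin–Faĭnleĭb / Halberstam–Richert (Lemma 5.4) in asymptotic form
(`LevinFainleibTauberian.lean`).  Everything here is PROVED.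

For a non-negative `g` with `g 1 = 1` and a prime `p` we study the local factor of the Dirichlet
series `∑ g(n) n^{-s}`,
`F_p(s) = ∑_ν g(p^ν) (p^ν)^{-s}` (`s ≥ 0`), written `∑' ν, g (p ^ ν) / ((p ^ ν : ℕ) : ℝ) ^ s`:

* consequences of the prime-power hypothesis (H2)
  `∑_{p ≤ N} g(p)² log p + ∑_{p ≤ N} ∑_{2 ≤ ν ≤ N} g(p^ν) log p^ν ≤ A`: each `ν ↦ g(p^ν)` is summable,
  the tails `T_p = ∑_{ν ≥ 2} g(p^ν)` have `∑_{p ≤ N} T_p ≤ A/(2 log 2)`, and `∑_{p ≤ N} g(p)² ≤ A/log 2`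
  (`summable_prime_pow`, `sum_primesLE_tsum_le`, `sum_primesLE_sq_le`);
* `F_p(s) = 1 + g(p) p^{-s} + T_p(s)` with `0 ≤ T_p(s) ≤ T_p` (`tsum_term_eq`), and the second-order
  estimate `|log F_p(s) + κ log(1 − p^{-1-s}) − (g(p) − κ/p) p^{-s}| ≤ T_p + 2g(p)² + 2T_p² + 2κ/p²`
  uniformly in `s ≥ 0` (`abs_logFactor_sub_main_le`), from `|log(1+u) − u| ≤ u²` (`u ≥ 0`, the tree's
  `LogEulerProduct.abs_log_one_add_sub_le_sq`) and `|log(1−v) + v| ≤ 2v²` (`v ≤ 1/2`);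
* continuity of `s ↦ log F_p(s) + κ log(1 − p^{-1-s})` on `[0, ∞)` (`continuousOn_logFactor`).

## References
* H. Halberstam, H.-E. Richert, *Sieve Methods*, Academic Press 1974, Lemma 5.4.
-/

namespace Literature.NumberTheory.LFunctions

namespace LevinFainleib

open Finset Real Filter

/-! ### An elementary logarithmic inequality

(The companion `|log(1+u) − u| ≤ u²` for `u ≥ 0` is the tree's
`Literature.NumberTheory.LFunctions.LogEulerProduct.abs_log_one_add_sub_le_sq`.) -/

/-- For `v ≤ 1/2`: `|log(1−v) + v| ≤ 2v²` (indeed `−v − 2v² ≤ −v/(1−v) ≤ log(1−v) ≤ −v`).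
[folklore] -/
theorem abs_log_one_sub_add_le_two_mul_sq {v : ℝ} (hv : v ≤ 1 / 2) :
    |Real.log (1 - v) + v| ≤ 2 * v ^ 2 := by
  have hpos : 0 < 1 - v := by linarith
  have h1 : Real.log (1 - v) ≤ -v := by linarith [Real.log_le_sub_one_of_pos hpos]
  have h2 : 1 - (1 - v)⁻¹ ≤ Real.log (1 - v) := Real.one_sub_inv_le_log_of_pos hpos
  have h3 : (1 - v)⁻¹ ≤ 1 + v + 2 * v ^ 2 := by
    rw [inv_eq_one_div, div_le_iff₀ hpos]
    nlinarith [mul_nonneg (sq_nonneg v) (by linarith : 0 ≤ 1 - 2 * v)]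
  rw [abs_le]; constructor <;> nlinarith

/-! ### Consequences of the prime-power hypothesis (H2) -/

section HypH2

variable {g : ℕ → ℝ} {A : ℝ}

/-- The summands `g(p^ν) log p^ν` of (H2) are non-negative. [folklore] -/
theorem prime_pow_mul_log_nonneg (hg0 : ∀ n, 0 ≤ g n) {p : ℕ} (hp : p.Prime) (ν : ℕ) :
    0 ≤ g (p ^ ν) * Real.log ((p : ℝ) ^ ν) :=
  mul_nonneg (hg0 _) (Real.log_nonneg (one_le_pow₀ (by exact_mod_cast hp.one_lt.le)))

/-- For a prime `p` and `ν ≥ 2`: `2 log 2 ≤ log p^ν`. [folklore] -/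
theorem two_mul_log_two_le_log_pow {p : ℕ} (hp : p.Prime) {ν : ℕ} (hν : 2 ≤ ν) :
    2 * Real.log 2 ≤ Real.log ((p : ℝ) ^ ν) := by
  rw [Real.log_pow]
  have h2 : (2 : ℝ) ≤ p := by exact_mod_cast hp.two_le
  exact mul_le_mul (by exact_mod_cast hν) (Real.log_le_log two_pos h2)
    (Real.log_nonneg one_le_two) (by positivity)

/-- (H2) bounds every rectangular partial sum: `∑_{p ≤ N} ∑_{2 ≤ ν ≤ K} g(p^ν) log p^ν ≤ A`.
[folklore] -/
theorem sum_primesLE_sum_Icc_le (hg0 : ∀ n, 0 ≤ g n)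
    (h2 : ∀ N : ℕ, (∑ p ∈ Nat.primesLE N, g p ^ 2 * Real.log p) +
      (∑ p ∈ Nat.primesLE N, ∑ ν ∈ Icc 2 N, g (p ^ ν) * Real.log ((p : ℝ) ^ ν)) ≤ A)
    (N K : ℕ) :
    ∑ p ∈ Nat.primesLE N, ∑ ν ∈ Icc 2 K, g (p ^ ν) * Real.log ((p : ℝ) ^ ν) ≤ A := by
  have hterm : ∀ p ∈ Nat.primesLE (max N K), ∀ ν, 0 ≤ g (p ^ ν) * Real.log ((p : ℝ) ^ ν) :=
    fun p hp ν => prime_pow_mul_log_nonneg hg0 (Nat.prime_of_mem_primesLE hp) ν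
  calc ∑ p ∈ Nat.primesLE N, ∑ ν ∈ Icc 2 K, g (p ^ ν) * Real.log ((p : ℝ) ^ ν)
      ≤ ∑ p ∈ Nat.primesLE (max N K), ∑ ν ∈ Icc 2 K, g (p ^ ν) * Real.log ((p : ℝ) ^ ν) :=
        Finset.sum_le_sum_of_subset_of_nonneg (Nat.primesLE_mono (le_max_left N K))
          (fun p hp _ => Finset.sum_nonneg fun ν _ => hterm p hp ν)
    _ ≤ ∑ p ∈ Nat.primesLE (max N K), ∑ ν ∈ Icc 2 (max N K),
          g (p ^ ν) * Real.log ((p : ℝ) ^ ν) :=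
        Finset.sum_le_sum fun p hp => Finset.sum_le_sum_of_subset_of_nonneg
          (Finset.Icc_subset_Icc le_rfl (le_max_right N K)) (fun ν _ _ => hterm p hp ν)
    _ ≤ A := by
        have h1 : 0 ≤ ∑ p ∈ Nat.primesLE (max N K), g p ^ 2 * Real.log p :=
          Finset.sum_nonneg fun p hp => mul_nonneg (sq_nonneg _)
            (Real.log_nonneg (by exact_mod_cast (Nat.prime_of_mem_primesLE hp).one_lt.le))
        linarith [h2 (max N K)]

/-- (H2) bounds the prime-power mass without the logarithm:
`∑_{p ≤ N} ∑_{ν < K} g(p^{ν+2}) ≤ A / (2 log 2)`. [folklore] -/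
theorem sum_primesLE_sum_range_le (hg0 : ∀ n, 0 ≤ g n)
    (h2 : ∀ N : ℕ, (∑ p ∈ Nat.primesLE N, g p ^ 2 * Real.log p) +
      (∑ p ∈ Nat.primesLE N, ∑ ν ∈ Icc 2 N, g (p ^ ν) * Real.log ((p : ℝ) ^ ν)) ≤ A)
    (N K : ℕ) :
    ∑ p ∈ Nat.primesLE N, ∑ ν ∈ range K, g (p ^ (ν + 2)) ≤ A / (2 * Real.log 2) := by
  have hlog2 : 0 < 2 * Real.log 2 := by positivity
  rw [le_div_iff₀ hlog2, Finset.sum_mul]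
  refine le_trans ?_ (sum_primesLE_sum_Icc_le hg0 h2 N (K + 1))
  refine Finset.sum_le_sum fun p hp => ?_
  have hp' := Nat.prime_of_mem_primesLE hp
  rw [Finset.sum_mul]
  calc ∑ ν ∈ range K, g (p ^ (ν + 2)) * (2 * Real.log 2)
      ≤ ∑ ν ∈ range K, g (p ^ (ν + 2)) * Real.log ((p : ℝ) ^ (ν + 2)) :=
        Finset.sum_le_sum fun ν _ => mul_le_mul_of_nonneg_left
          (two_mul_log_two_le_log_pow hp' (by omega)) (hg0 _)
    _ = ∑ μ ∈ (range K).image (· + 2), g (p ^ μ) * Real.log ((p : ℝ) ^ μ) := by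
        rw [Finset.sum_image fun x _ y _ h => by simpa using h]
    _ ≤ ∑ ν ∈ Icc 2 (K + 1), g (p ^ ν) * Real.log ((p : ℝ) ^ ν) := by
        refine Finset.sum_le_sum_of_subset_of_nonneg (fun μ hμ => ?_)
          (fun ν _ _ => prime_pow_mul_log_nonneg hg0 hp' ν)
        obtain ⟨x, hx, rfl⟩ := Finset.mem_image.mp hμ
        rw [Finset.mem_range] at hx
        rw [Finset.mem_Icc]; omega

/-- (H2) ⇒ for every prime `p`, `ν ↦ g(p^{ν+2})` is summable. [folklore] -/
theorem summable_prime_pow_add_two (hg0 : ∀ n, 0 ≤ g n)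
    (h2 : ∀ N : ℕ, (∑ p ∈ Nat.primesLE N, g p ^ 2 * Real.log p) +
      (∑ p ∈ Nat.primesLE N, ∑ ν ∈ Icc 2 N, g (p ^ ν) * Real.log ((p : ℝ) ^ ν)) ≤ A)
    {p : ℕ} (hp : p.Prime) : Summable (fun ν => g (p ^ (ν + 2))) := by
  refine summable_of_sum_range_le (c := A / (2 * Real.log 2)) (fun _ => hg0 _) (fun K => ?_)
  refine le_trans ?_ (sum_primesLE_sum_range_le hg0 h2 p K)
  have hmem : p ∈ Nat.primesLE p := Nat.mem_primesLE.mpr ⟨le_rfl, hp⟩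
  exact Finset.single_le_sum (f := fun q => ∑ ν ∈ range K, g (q ^ (ν + 2)))
    (fun q _ => Finset.sum_nonneg fun ν _ => hg0 _) hmem

/-- (H2) ⇒ for every prime `p`, `ν ↦ g(p^ν)` is summable. [folklore] -/
theorem summable_prime_pow (hg0 : ∀ n, 0 ≤ g n)
    (h2 : ∀ N : ℕ, (∑ p ∈ Nat.primesLE N, g p ^ 2 * Real.log p) +
      (∑ p ∈ Nat.primesLE N, ∑ ν ∈ Icc 2 N, g (p ^ ν) * Real.log ((p : ℝ) ^ ν)) ≤ A)
    {p : ℕ} (hp : p.Prime) : Summable (fun ν => g (p ^ ν)) :=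
  (summable_nat_add_iff 2).mp (summable_prime_pow_add_two hg0 h2 hp)

/-- (H2) ⇒ the tails `T_p = ∑_{ν ≥ 2} g(p^ν)` have bounded sum over the primes:
`∑_{p ≤ N} T_p ≤ A / (2 log 2)`. [folklore] -/
theorem sum_primesLE_tsum_le (hg0 : ∀ n, 0 ≤ g n)
    (h2 : ∀ N : ℕ, (∑ p ∈ Nat.primesLE N, g p ^ 2 * Real.log p) +
      (∑ p ∈ Nat.primesLE N, ∑ ν ∈ Icc 2 N, g (p ^ ν) * Real.log ((p : ℝ) ^ ν)) ≤ A)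
    (N : ℕ) :
    ∑ p ∈ Nat.primesLE N, ∑' ν, g (p ^ (ν + 2)) ≤ A / (2 * Real.log 2) := by
  rw [← Summable.tsum_finsetSum
    (fun p hp => summable_prime_pow_add_two hg0 h2 (Nat.prime_of_mem_primesLE hp))]
  refine Real.tsum_le_of_sum_range_le (fun ν => Finset.sum_nonneg fun p _ => hg0 _) (fun K => ?_)
  rw [Finset.sum_comm]
  exact sum_primesLE_sum_range_le hg0 h2 N K

/-- (H2) ⇒ each tail is bounded: `T_p ≤ A / (2 log 2)`. [folklore] -/
theorem tsum_prime_pow_add_two_le (hg0 : ∀ n, 0 ≤ g n)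
    (h2 : ∀ N : ℕ, (∑ p ∈ Nat.primesLE N, g p ^ 2 * Real.log p) +
      (∑ p ∈ Nat.primesLE N, ∑ ν ∈ Icc 2 N, g (p ^ ν) * Real.log ((p : ℝ) ^ ν)) ≤ A)
    {p : ℕ} (hp : p.Prime) : ∑' ν, g (p ^ (ν + 2)) ≤ A / (2 * Real.log 2) := by
  refine le_trans ?_ (sum_primesLE_tsum_le hg0 h2 p)
  have hmem : p ∈ Nat.primesLE p := Nat.mem_primesLE.mpr ⟨le_rfl, hp⟩
  exact Finset.single_le_sum (f := fun q => ∑' ν, g (q ^ (ν + 2)))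
    (fun q _ => tsum_nonneg fun ν => hg0 _) hmem

/-- (H2) ⇒ `∑_{p ≤ N} g(p)² ≤ A / log 2`. [folklore] -/
theorem sum_primesLE_sq_le (hg0 : ∀ n, 0 ≤ g n)
    (h2 : ∀ N : ℕ, (∑ p ∈ Nat.primesLE N, g p ^ 2 * Real.log p) +
      (∑ p ∈ Nat.primesLE N, ∑ ν ∈ Icc 2 N, g (p ^ ν) * Real.log ((p : ℝ) ^ ν)) ≤ A)
    (N : ℕ) : ∑ p ∈ Nat.primesLE N, g p ^ 2 ≤ A / Real.log 2 := by
  have hlog2 : 0 < Real.log 2 := Real.log_pos one_lt_two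
  rw [le_div_iff₀ hlog2, Finset.sum_mul]
  have h1 : ∑ p ∈ Nat.primesLE N, g p ^ 2 * Real.log 2
      ≤ ∑ p ∈ Nat.primesLE N, g p ^ 2 * Real.log p :=
    Finset.sum_le_sum fun p hp => mul_le_mul_of_nonneg_left
      (Real.log_le_log two_pos (by exact_mod_cast (Nat.prime_of_mem_primesLE hp).two_le))
      (sq_nonneg _)
  have h0 : 0 ≤ ∑ p ∈ Nat.primesLE N, ∑ ν ∈ Icc 2 N, g (p ^ ν) * Real.log ((p : ℝ) ^ ν) :=
    Finset.sum_nonneg fun p hp => Finset.sum_nonneg fun ν _ =>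
      prime_pow_mul_log_nonneg hg0 (Nat.prime_of_mem_primesLE hp) ν
  linarith [h2 N]

end HypH2

/-! ### The local factor `F_p(s) = ∑_ν g(p^ν) (p^ν)^{-s}` -/

section Local

variable {g : ℕ → ℝ} {p : ℕ} {s : ℝ}

/-- `1 ≤ p^ν` in `ℝ`. [folklore] -/
theorem one_le_cast_prime_pow (hp : p.Prime) (ν : ℕ) : (1 : ℝ) ≤ ((p ^ ν : ℕ) : ℝ) := by
  exact_mod_cast Nat.one_le_pow ν p hp.pos

/-- The terms `g(p^ν) (p^ν)^{-s}` are non-negative. [folklore] -/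
theorem term_nonneg (hg0 : ∀ n, 0 ≤ g n) (p ν : ℕ) (s : ℝ) :
    0 ≤ g (p ^ ν) / ((p ^ ν : ℕ) : ℝ) ^ s :=
  div_nonneg (hg0 _) (Real.rpow_nonneg (Nat.cast_nonneg _) _)

/-- For `s ≥ 0`: `g(p^ν) (p^ν)^{-s} ≤ g(p^ν)`. [folklore] -/
theorem term_le (hg0 : ∀ n, 0 ≤ g n) (hp : p.Prime) (ν : ℕ) (hs : 0 ≤ s) :
    g (p ^ ν) / ((p ^ ν : ℕ) : ℝ) ^ s ≤ g (p ^ ν) :=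
  div_le_self (hg0 _) (Real.one_le_rpow (one_le_cast_prime_pow hp ν) hs)

/-- For `s ≥ 0` the local factor series converges as soon as `ν ↦ g(p^ν)` is summable. [folklore] -/
theorem summable_term (hg0 : ∀ n, 0 ≤ g n) (hsum : Summable fun ν => g (p ^ ν)) (hp : p.Prime)
    (hs : 0 ≤ s) : Summable fun ν => g (p ^ ν) / ((p ^ ν : ℕ) : ℝ) ^ s :=
  Summable.of_nonneg_of_le (fun ν => term_nonneg hg0 p ν s) (fun ν => term_le hg0 hp ν hs) hsum

/-- **`F_p(s) = 1 + g(p) p^{-s} + T_p(s)`** with `T_p(s) = ∑_{ν ≥ 2} g(p^ν)(p^ν)^{-s}`. [folklore] -/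
theorem tsum_term_eq (hg0 : ∀ n, 0 ≤ g n) (hg1 : g 1 = 1) (hsum : Summable fun ν => g (p ^ ν))
    (hp : p.Prime) (hs : 0 ≤ s) :
    ∑' ν, g (p ^ ν) / ((p ^ ν : ℕ) : ℝ) ^ s
      = 1 + g p / (p : ℝ) ^ s + ∑' ν, g (p ^ (ν + 2)) / ((p ^ (ν + 2) : ℕ) : ℝ) ^ s := by
  rw [← (summable_term hg0 hsum hp hs).sum_add_tsum_nat_add 2]
  simp [Finset.sum_range_succ, hg1]

/-- `0 ≤ T_p(s) ≤ T_p = ∑_{ν ≥ 2} g(p^ν)` for `s ≥ 0`. [folklore] -/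
theorem tsum_tail_nonneg_le (hg0 : ∀ n, 0 ≤ g n) (hsum : Summable fun ν => g (p ^ ν))
    (hp : p.Prime) (hs : 0 ≤ s) :
    0 ≤ ∑' ν, g (p ^ (ν + 2)) / ((p ^ (ν + 2) : ℕ) : ℝ) ^ s ∧
      ∑' ν, g (p ^ (ν + 2)) / ((p ^ (ν + 2) : ℕ) : ℝ) ^ s ≤ ∑' ν, g (p ^ (ν + 2)) := by
  have hsum2 : Summable fun ν => g (p ^ (ν + 2)) := (summable_nat_add_iff 2).mpr hsum
  have hsum2s : Summable fun ν => g (p ^ (ν + 2)) / ((p ^ (ν + 2) : ℕ) : ℝ) ^ s :=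
    (summable_nat_add_iff (f := fun ν => g (p ^ ν) / ((p ^ ν : ℕ) : ℝ) ^ s) 2).mpr
      (summable_term hg0 hsum hp hs)
  exact ⟨tsum_nonneg fun ν => term_nonneg hg0 p _ s,
    Summable.tsum_le_tsum (fun ν => term_le hg0 hp _ hs) hsum2s hsum2⟩

/-- `1 ≤ F_p(s)` for `s ≥ 0` (the `ν = 0` term is `g(1) = 1`). [folklore] -/
theorem one_le_tsum_term (hg0 : ∀ n, 0 ≤ g n) (hg1 : g 1 = 1)
    (hsum : Summable fun ν => g (p ^ ν)) (hp : p.Prime) (hs : 0 ≤ s) :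
    1 ≤ ∑' ν, g (p ^ ν) / ((p ^ ν : ℕ) : ℝ) ^ s := by
  rw [tsum_term_eq hg0 hg1 hsum hp hs]
  have h1 : 0 ≤ g p / (p : ℝ) ^ s := div_nonneg (hg0 _) (Real.rpow_nonneg (Nat.cast_nonneg _) _)
  linarith [(tsum_tail_nonneg_le hg0 hsum hp hs).1]

/-- At `s = 0` the local factor is `∑_ν g(p^ν)`. [folklore] -/
theorem tsum_term_zero (g : ℕ → ℝ) (p : ℕ) :
    ∑' ν, g (p ^ ν) / ((p ^ ν : ℕ) : ℝ) ^ (0 : ℝ) = ∑' ν, g (p ^ ν) := by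
  simp

/-- **The second-order estimate for `log F_p(s)`**: for `s ≥ 0`,
`|log F_p(s) − g(p) p^{-s}| ≤ T_p + 2 g(p)² + 2 T_p²`. [cite: HalberstamRichert1974, Lemma 5.4] -/
theorem abs_log_tsum_term_sub_le (hg0 : ∀ n, 0 ≤ g n) (hg1 : g 1 = 1)
    (hsum : Summable fun ν => g (p ^ ν)) (hp : p.Prime) (hs : 0 ≤ s) :
    |Real.log (∑' ν, g (p ^ ν) / ((p ^ ν : ℕ) : ℝ) ^ s) - g p / (p : ℝ) ^ s|
      ≤ (∑' ν, g (p ^ (ν + 2))) + 2 * g p ^ 2 + 2 * (∑' ν, g (p ^ (ν + 2))) ^ 2 := by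
  obtain ⟨hTs0, hTsT⟩ := tsum_tail_nonneg_le hg0 hsum hp hs
  set T := ∑' ν, g (p ^ (ν + 2)) with hT
  set Ts := ∑' ν, g (p ^ (ν + 2)) / ((p ^ (ν + 2) : ℕ) : ℝ) ^ s with hTs
  set a := g p / (p : ℝ) ^ s with ha
  have ha0 : 0 ≤ a := div_nonneg (hg0 _) (Real.rpow_nonneg (Nat.cast_nonneg _) _)
  have hag : a ≤ g p :=
    div_le_self (hg0 _) (Real.one_le_rpow (by exact_mod_cast hp.one_lt.le) hs)
  have hF : ∑' ν, g (p ^ ν) / ((p ^ ν : ℕ) : ℝ) ^ s = 1 + (a + Ts) := by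
    rw [tsum_term_eq hg0 hg1 hsum hp hs, add_assoc]
  rw [hF]
  have hlog := LogEulerProduct.abs_log_one_add_sub_le_sq (add_nonneg ha0 hTs0)
  have hsq : (a + Ts) ^ 2 ≤ 2 * g p ^ 2 + 2 * T ^ 2 := by
    nlinarith [sq_nonneg (a - Ts), mul_le_mul hag hag ha0 (hg0 p),
      mul_le_mul hTsT hTsT hTs0 (le_trans hTs0 hTsT)]
  rw [abs_le] at hlog ⊢
  constructor <;> nlinarith

/-- `0 < 1/p^{1+s} ≤ 1/p ≤ 1/2` for a prime `p` and `s ≥ 0`. [folklore] -/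
theorem inv_rpow_bounds (hp : p.Prime) (hs : 0 ≤ s) :
    0 < 1 / (p : ℝ) ^ (1 + s) ∧ 1 / (p : ℝ) ^ (1 + s) ≤ 1 / p ∧ 1 / (p : ℝ) ≤ 1 / 2 := by
  have hp2 : (2 : ℝ) ≤ p := by exact_mod_cast hp.two_le
  have hp0 : (0 : ℝ) < p := by linarith
  refine ⟨div_pos one_pos (Real.rpow_pos_of_pos hp0 _), ?_, ?_⟩
  · refine one_div_le_one_div_of_le hp0 ?_
    calc (p : ℝ) = (p : ℝ) ^ (1 : ℝ) := (Real.rpow_one _).symm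
      _ ≤ (p : ℝ) ^ (1 + s) := Real.rpow_le_rpow_of_exponent_le (by linarith) (by linarith)
  · exact one_div_le_one_div_of_le two_pos hp2

/-- `1/p^{1+s} = (1/p) · p^{-s}`. [folklore] -/
theorem one_div_rpow_one_add (hp : p.Prime) (s : ℝ) :
    1 / (p : ℝ) ^ (1 + s) = 1 / p / (p : ℝ) ^ s := by
  have hp0 : (0 : ℝ) < p := by exact_mod_cast hp.pos
  rw [Real.rpow_add hp0, Real.rpow_one, div_div]

/-- **The local factor against the zeta factor, to second order**: for a prime `p`, `κ ≥ 0` and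
`s ≥ 0`,
`|log F_p(s) + κ log(1 − p^{-1-s}) − (g(p) − κ/p) p^{-s}| ≤ T_p + 2g(p)² + 2T_p² + 2κ/p²`.
[cite: HalberstamRichert1974, Lemma 5.4] -/
theorem abs_logFactor_sub_main_le (hg0 : ∀ n, 0 ≤ g n) (hg1 : g 1 = 1)
    (hsum : Summable fun ν => g (p ^ ν)) (hp : p.Prime) {κ : ℝ} (hκ : 0 ≤ κ) (hs : 0 ≤ s) :
    |Real.log (∑' ν, g (p ^ ν) / ((p ^ ν : ℕ) : ℝ) ^ s)
        + κ * Real.log (1 - 1 / (p : ℝ) ^ (1 + s)) - (g p - κ / p) / (p : ℝ) ^ s|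
      ≤ (∑' ν, g (p ^ (ν + 2))) + 2 * g p ^ 2 + 2 * (∑' ν, g (p ^ (ν + 2))) ^ 2
        + 2 * κ / (p : ℝ) ^ 2 := by
  obtain ⟨hv0, hvp, hp2⟩ := inv_rpow_bounds hp hs
  set v := 1 / (p : ℝ) ^ (1 + s) with hv
  have hA := abs_log_tsum_term_sub_le hg0 hg1 hsum hp hs
  have hB := abs_log_one_sub_add_le_two_mul_sq (hvp.trans hp2)
  have hsplit : Real.log (∑' ν, g (p ^ ν) / ((p ^ ν : ℕ) : ℝ) ^ s)
        + κ * Real.log (1 - v) - (g p - κ / p) / (p : ℝ) ^ s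
      = (Real.log (∑' ν, g (p ^ ν) / ((p ^ ν : ℕ) : ℝ) ^ s) - g p / (p : ℝ) ^ s)
        + κ * (Real.log (1 - v) + v) := by
    have : κ / p / (p : ℝ) ^ s = κ * v := by
      rw [hv, one_div_rpow_one_add hp s]; ring
    rw [sub_div, this]; ring
  rw [hsplit]
  have hv2 : v ^ 2 ≤ 1 / (p : ℝ) ^ 2 :=
    calc v ^ 2 ≤ (1 / (p : ℝ)) ^ 2 := pow_le_pow_left₀ hv0.le hvp 2
      _ = 1 / (p : ℝ) ^ 2 := by rw [one_div_pow]
  calc |(Real.log (∑' ν, g (p ^ ν) / ((p ^ ν : ℕ) : ℝ) ^ s) - g p / (p : ℝ) ^ s)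
        + κ * (Real.log (1 - v) + v)|
      ≤ |Real.log (∑' ν, g (p ^ ν) / ((p ^ ν : ℕ) : ℝ) ^ s) - g p / (p : ℝ) ^ s|
        + |κ * (Real.log (1 - v) + v)| := abs_add_le _ _
    _ ≤ ((∑' ν, g (p ^ (ν + 2))) + 2 * g p ^ 2 + 2 * (∑' ν, g (p ^ (ν + 2))) ^ 2)
        + κ * (2 * v ^ 2) := by
        rw [abs_mul, abs_of_nonneg hκ]
        exact add_le_add hA (mul_le_mul_of_nonneg_left hB hκ)
    _ ≤ _ := by
        have : κ * (2 * v ^ 2) ≤ 2 * κ / (p : ℝ) ^ 2 := by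
          rw [show 2 * κ / (p : ℝ) ^ 2 = κ * (2 * (1 / (p : ℝ) ^ 2)) by ring]
          exact mul_le_mul_of_nonneg_left (by linarith) hκ
        linarith

/-- `0 < 1 − p^{-1-s}` for a prime `p` and `s ≥ 0`. [folklore] -/
theorem one_sub_inv_rpow_pos (hp : p.Prime) (hs : 0 ≤ s) : 0 < 1 - 1 / (p : ℝ) ^ (1 + s) := by
  obtain ⟨-, hvp, hp2⟩ := inv_rpow_bounds hp hs
  linarith

/-- Positivity of the two factors: `0 < F_p(s)` and `0 < 1 − p^{-1-s}` (`s ≥ 0`). [folklore] -/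
theorem factor_pos (hg0 : ∀ n, 0 ≤ g n) (hg1 : g 1 = 1) (hsum : Summable fun ν => g (p ^ ν))
    (hp : p.Prime) (hs : 0 ≤ s) :
    0 < ∑' ν, g (p ^ ν) / ((p ^ ν : ℕ) : ℝ) ^ s ∧ 0 < 1 - 1 / (p : ℝ) ^ (1 + s) :=
  ⟨lt_of_lt_of_le one_pos (one_le_tsum_term hg0 hg1 hsum hp hs), one_sub_inv_rpow_pos hp hs⟩

/-- **Continuity of the local factor in `s ≥ 0`**:
`s ↦ log F_p(s) + κ log(1 − p^{-1-s})` is continuous on `[0, ∞)` (dominated convergence for the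
series, with the summable majorant `g(p^ν)`). [folklore] -/
theorem continuousOn_logFactor (hg0 : ∀ n, 0 ≤ g n) (hg1 : g 1 = 1)
    (hsum : Summable fun ν => g (p ^ ν)) (hp : p.Prime) (κ : ℝ) :
    ContinuousOn (fun s : ℝ => Real.log (∑' ν, g (p ^ ν) / ((p ^ ν : ℕ) : ℝ) ^ s)
      + κ * Real.log (1 - 1 / (p : ℝ) ^ (1 + s))) (Set.Ici 0) := by
  have hp0 : (0 : ℝ) < p := by exact_mod_cast hp.pos
  have hF : ContinuousOn (fun s : ℝ => ∑' ν, g (p ^ ν) / ((p ^ ν : ℕ) : ℝ) ^ s) (Set.Ici 0) := by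
    refine continuousOn_tsum (fun ν => ?_) hsum (fun ν s hs => ?_)
    · have hc : (0 : ℝ) < ((p ^ ν : ℕ) : ℝ) := lt_of_lt_of_le one_pos (one_le_cast_prime_pow hp ν)
      refine (continuous_const.div ?_ fun s => (Real.rpow_pos_of_pos hc s).ne').continuousOn
      exact continuous_iff_continuousAt.mpr fun s => Real.continuousAt_const_rpow hc.ne'
    · rw [Real.norm_of_nonneg (term_nonneg hg0 p ν s)]
      exact term_le hg0 hp ν hs
  have hZ : ContinuousOn (fun s : ℝ => 1 - 1 / (p : ℝ) ^ (1 + s)) (Set.Ici 0) := by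
    refine (continuous_const.sub (continuous_const.div ?_ fun s => ?_)).continuousOn
    · exact (continuous_iff_continuousAt.mpr fun s => Real.continuousAt_const_rpow hp0.ne').comp
        (continuous_const.add continuous_id)
    · exact (Real.rpow_pos_of_pos hp0 _).ne'
  refine (hF.log fun s hs => ?_).add (continuousOn_const.mul (hZ.log fun s hs => ?_))
  · exact (factor_pos hg0 hg1 hsum hp hs).1.ne'
  · exact (factor_pos hg0 hg1 hsum hp hs).2.ne'

end Local

end LevinFainleib

end Literature.NumberTheory.LFunctions
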